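import Mathlib
import Summits.QuantumFields.YangMills.Theorems.BalabanUVNodesN15BackgroundLayerEntries
import HarnessLib

/-!
# Route «BalabanUVNodes» (cluster K4 «SpineRates»), Track-A DAG node N15 = spine estimate NE2, BACKGROUND LAYER — THE NODE'S FIRST CONJUNCT
# `T4EtaRate.NE2PlusOperator` BY NAME WITH ALL FOUR (3.42) ENTRIES OF THE BACKGROUND-DEPENDENT PAIR CONSTRUCTED and ONLY the `U ≡ 1` layer displayed

Cell `pub-ymgap`, seat `pub-ymgap-dag-n15-b` (generation g5; FIRST-MISSING-ESTIMATE, HUMAN RULING D-0062; chair R424 venue; ROSTER-D0062 l.26).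
`bears_on: R4∕N15`.  Filed `--supports stmt-QuantumFields-19351` (helper).  THEOREMS + 2 defs; imports parts A1–A3 `…N15.BackgroundLayer` (`bgProp`, `bgSource`,
`bgDerived`, `coeffBg`, `bgInstance`, `hasMaj_entry0_background`, `hasMaj_entry2_background`, `hasMaj_entry13_background`, `bgConst`, `bgConst1`,
`one_le_pref4`) and g0's `…N15.OperatorReadout` BY NAME; nothing in the tree is modified.

THE POINT.  Part A2's by-name statement displayed entries 1–3 as the consumer's operators; part A3 constructed them.  This file assembles: the four
entry operators `bgOps4` of the background-dependent pair — `𝔇(X′, X)`, `𝔇(Y₁′, Y₁)`, `𝔇(Z′, Z)`, `𝔇(Y₃′, Y₃)` with `X = bgProp G c̄` ((3.64)), `Y_i = bgDerived G D_i c̄`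
(`∇G`∕`ΔG` entries), `Z = bgSource G S c̄` (`G∇*` entry), `c̄ = blockAvg π c′`, primed objects at the fine configuration `c′` — and proves `EtaRateIneq342` per
index with explicit constants and `NE2PlusOperator` for any family, the ONLY displayed hypotheses being the NE2⁰ OPERATOR LAYER of the `U ≡ 1` pieces:
decaying block majorants `β·e^{−δd}` of `G`, `G′`, `S` (= `G∇*`), `D₁′`, `D₃′` (= `∇′G′`, `Δ′G′`) and the four η-defects `𝔇(G′,G)`, `𝔇(D₁′,D₁)`, `𝔇(S′,S)`,
`𝔇(D₃′,D₃) ≤ m₀·θ·e^{−δd}` with the instance's rate number `θ ≤ (L^j)^{−γ}` — exactly the shape -a parts 15∕16∕23 prove on the unit torus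
(`hasMaj_entry0…3`, uniform `B·(L^k)⁻¹·e^{−ρ|y−y′|_T}`) plus plain majorants.

THE PRINT (SHAPES and quantifier template only; nothing of [B9] asserted).  [Balaban1985BackgroundPropagators] Thm 3.1 (3.42) p. 397 (the four sup
entries *«|(G′λ)(x)|, |(∇_U G′λ)(x)|, |(G′∇*_U λ)(x)|, |(Δ_U G′λ)(x)|»*, `M ≥ M₅`, `Mα₀ ≤ a₀`, (3.35)); [King1986] Prop. 3.9 (3.73) p. 665 (the derivative
kernel as a separate kernel with its own rate: shape).

CONTENTS ([folklore] bookkeeping; 2 defs).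
* §1 `bgOps4`, `bgFamily4` (the kernel family over the coefficient carrier `coeffBg`, A2), `bgOps4_zero` … (unfoldings).
* §2 **`etaRateIneq342_background4`** — PER INDEX, EXPLICIT CONSTANTS: `EtaRateIneq342 … (bgConst + bgConst1) (δ − σ) γ c′` for every `Reg335`-regular `c′`
  under the guard (the content, stated per index as ref-B READ #323 asks).
* §3 **`ne2PlusOperator_background4`** — `NE2PlusOperator c₃₅ (bgInstance …) (bgFamily4 …)` for ANY family with UNIFORM `U ≡ 1` letters; `M₅ := 1`,
  `a₀ := (2c₃₅(βc_r + 1))⁻¹`, `B₀ := bgConst + bgConst1 + 1`, `δ₀ := δ − σ`; the «+» block CONSUMED (A2).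

HONEST FRAMING ∕ LIMITS.  As parts A1–A3: bookkeeping + finite-dimensional linear algebra over hypothesis-shaped data; the `U ≡ 1` layer DISPLAYED, not proved
here; scalar coefficients, zeroth-order perturbation species, linearised transport, sites of physical size `≥ 1`; the guard reads the datum's `M` (live iff
the consumer's family has unbounded `M`; §2 is the unconditional per-index content); nothing about Bałaban's `G(U)` of [B6]∕[B9] asserted.  NE2⁺ NOT
PRINTED, NOT proved; count-neutral (typed 28∕28; nothing discharged); N15 NOT discharged; one finite lattice at fixed ε — NOT infinite volume, NOT OS on
ℝ⁴, NOT a mass gap, NOT Clay.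
-/

noncomputable section

namespace Summit.QuantumFields.YangMills.BalabanUVNodes.N15.BackgroundLayer

open Literature.MathematicalPhysics.QuantumFieldTheory.Balaban1983to89
open Literature.MathematicalPhysics.QuantumFieldTheory.Balaban1983to89.B11SectG (BlockNorm HasMaj RowSum)
open Literature.MathematicalPhysics.QuantumFieldTheory.Balaban1983to89.T4EtaRate (PairedInstance EtaRateIneq342 NE2PlusOperator rateFactor)
open Literature.MathematicalPhysics.QuantumFieldTheory.Balaban1983to89.T4EtaRateDefect (idef rateWeight)
open Literature.MathematicalPhysics.QuantumFieldTheory.Balaban1983to89.T4EtaRateCoeffDefect (pull blockAvg)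
open Literature.MathematicalPhysics.QuantumFieldTheory.Balaban1983to89.B6RandomWalk (Triangle254)
open Summit.QuantumFields.YangMills.BalabanUVNodes.N15.OperatorReadout (opGeo opFamily opGeo_len rateFactor_opGeo etaRateIneq342_of_hasMaj)

/-! ## §1 The four constructed entry operators and the kernel family -/

section Family

variable {X X' : Type} [Fintype X] [Fintype X'] [DecidableEq X] [DecidableEq X'] {g : B6.Geometry}

/-- THE FOUR ENTRY OPERATORS OF THE BACKGROUND-DEPENDENT PAIR, ALL CONSTRUCTED: entry 0 `𝔇(X′, X)` (A1 `bgProp`), entries 1∕3 `𝔇(Y′, Y)` of the derived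
objects of the `U ≡ 1` derived pieces `D₁` (= `∇G`), `D₃` (= `ΔG`) (A3 `bgDerived`), entry 2 `𝔇(Z′, Z)` of the source step with the source piece `S` (= `G∇*`)
(A3 `bgSource`); coarse coefficient = the block average. [cite: Balaban1985BackgroundPropagators, (3.42) p.397 (the four entries: shape)] -/
def bgOps4 (π : X' → X) (G D₁ S D₃ : (X → ℝ) →ₗ[ℝ] (X → ℝ)) (G' D₁' S' D₃' : (X' → ℝ) →ₗ[ℝ] (X' → ℝ)) :
    Fin 4 → (X' → ℝ) → ((X → ℝ) →ₗ[ℝ] (X' → ℝ)) :=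
  fun n c' => ![idef (pull π) (pull π) (bgProp G' c') (bgProp G (blockAvg π c')),
    idef (pull π) (pull π) (bgDerived G' D₁' c') (bgDerived G D₁ (blockAvg π c')),
    idef (pull π) (pull π) (bgSource G' S' c') (bgSource G S (blockAvg π c')),
    idef (pull π) (pull π) (bgDerived G' D₃' c') (bgDerived G D₃ (blockAvg π c'))] n

/-- THE KERNEL FAMILY of the realised instance with all four entries constructed (g0 `opFamily` over A2's carrier `coeffBg`).
[cite: Balaban1985BackgroundPropagators, (3.42) p.397 (the four sup entries: shape)] -/
def bgFamily4 (blk : X → g.Site) (π : X' → X) (n : ℕ) (hL : g.L ≠ 0) (θc θ : ℝ) (G D₁ S D₃ : (X → ℝ) →ₗ[ℝ] (X → ℝ))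
    (G' D₁' S' D₃' : (X' → ℝ) →ₗ[ℝ] (X' → ℝ)) : B9.KernelFamily (bgInstance blk π n hL θc θ).gc (bgInstance blk π n hL θc θ).Bf :=
  show B9.KernelFamily (opGeo g X blk) (coeffBg π g.M θ) from
    opFamily (g := g) (B := coeffBg π g.M θ) blk (blk ∘ π) (bgOps4 π G D₁ S D₃ G' D₁' S' D₃')

end Family

/-! ## §2 Per index: `EtaRateIneq342` with explicit constants, all four entries constructed -/

section PerIndex

variable {X X' : Type} [Fintype X] [Fintype X'] [DecidableEq X] [DecidableEq X'] {g : B6.Geometry} (blk : X → g.Site) (π : X' → X)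

/-- **`EtaRateIneq342` PER INDEX, ALL FOUR ENTRIES CONSTRUCTED, EXPLICIT CONSTANTS.**  Data: a [B6] carrier ((2.54), `d ≥ 0`, (2.61) at `σ ≥ 0` with
`c_r ≥ 0`, `η, L > 0`, sites of physical size `≥ 1`); lattices blocked and paired; the `U ≡ 1` LAYER — coarse majorants `G, S ≤ β·e^{−δd}`, fine majorants
`G′, D₁′, D₃′ ≤ β·e^{−δd}` (`σ ≤ δ`) and the four η-defects `𝔇(G′,G), 𝔇(D₁′,D₁), 𝔇(S′,S), 𝔇(D₃′,D₃) ≤ m₀·θ·e^{−δd}` with `0 ≤ θ ≤ (L^j)^{−γ}` at every site;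
`c₃₅ > 0`, the guard `a₀ ≥ 0`, `β(c₃₅a₀)c_r ≤ ½`, `M ≥ 1`, `α₀ > 0`, `M·α₀ ≤ a₀`.  Then for every `c′` with `(coeffBg π M θ).Reg335 c₃₅ α₀ c′`:
`EtaRateIneq342 (opFamily blk (blk∘π) (bgOps4 …)) (bgConst + bgConst1) (δ − σ) γ c′`. [cite: Balaban1985BackgroundPropagators, Thm 3.1 (3.42) p.397 (shape, quantifier template)] -/
theorem etaRateIneq342_background4 (htri : Triangle254 g) (hd : ∀ a b : g.Site, 0 ≤ g.dist a b) {σ cr : ℝ} (hσ : 0 ≤ σ) (hcr : 0 ≤ cr)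
    (hrow : RowSum g σ cr) (hη : 0 < g.eta) (hL : 0 < g.L) (hlen : ∀ y, 1 ≤ g.len y) {δ β m₀ θ c35 a₀ M α₀ γ : ℝ}
    (hσδ : σ ≤ δ) (hβ : 0 ≤ β) (hm₀ : 0 ≤ m₀) (hθ : 0 ≤ θ) (hθγ : ∀ y, θ ≤ rateWeight g γ y) (hc35 : 0 < c35) (ha₀ : 0 ≤ a₀)
    (hq : β * (c35 * a₀) * cr ≤ 1 / 2) (hM : 1 ≤ M) (hα₀ : 0 < α₀) (hMα : M * α₀ ≤ a₀)
    {G D₁ S D₃ : (X → ℝ) →ₗ[ℝ] (X → ℝ)} {G' D₁' S' D₃' : (X' → ℝ) →ₗ[ℝ] (X' → ℝ)}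
    (hG : HasMaj (BlockNorm.ofBlocks g blk) (BlockNorm.ofBlocks g blk) G (fun y y' => β * Real.exp (-(δ * g.dist y y'))))
    (hG' : HasMaj (BlockNorm.ofBlocks g (blk ∘ π)) (BlockNorm.ofBlocks g (blk ∘ π)) G' (fun y y' => β * Real.exp (-(δ * g.dist y y'))))
    (hS : HasMaj (BlockNorm.ofBlocks g blk) (BlockNorm.ofBlocks g blk) S (fun y y' => β * Real.exp (-(δ * g.dist y y'))))
    (hD₁' : HasMaj (BlockNorm.ofBlocks g (blk ∘ π)) (BlockNorm.ofBlocks g (blk ∘ π)) D₁' (fun y y' => β * Real.exp (-(δ * g.dist y y'))))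
    (hD₃' : HasMaj (BlockNorm.ofBlocks g (blk ∘ π)) (BlockNorm.ofBlocks g (blk ∘ π)) D₃' (fun y y' => β * Real.exp (-(δ * g.dist y y'))))
    (hDG : HasMaj (BlockNorm.ofBlocks g blk) (BlockNorm.ofBlocks g (blk ∘ π)) (idef (pull π) (pull π) G' G)
      (fun y y' => m₀ * θ * Real.exp (-(δ * g.dist y y'))))
    (hDD₁ : HasMaj (BlockNorm.ofBlocks g blk) (BlockNorm.ofBlocks g (blk ∘ π)) (idef (pull π) (pull π) D₁' D₁)
      (fun y y' => m₀ * θ * Real.exp (-(δ * g.dist y y'))))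
    (hDS : HasMaj (BlockNorm.ofBlocks g blk) (BlockNorm.ofBlocks g (blk ∘ π)) (idef (pull π) (pull π) S' S)
      (fun y y' => m₀ * θ * Real.exp (-(δ * g.dist y y'))))
    (hDD₃ : HasMaj (BlockNorm.ofBlocks g blk) (BlockNorm.ofBlocks g (blk ∘ π)) (idef (pull π) (pull π) D₃' D₃)
      (fun y y' => m₀ * θ * Real.exp (-(δ * g.dist y y'))))
    {c' : X' → ℝ} (hreg : (coeffBg π M θ).Reg335 c35 α₀ c') :
    EtaRateIneq342 (opFamily (g := g) (B := coeffBg π M θ) blk (blk ∘ π) (bgOps4 π G D₁ S D₃ G' D₁' S' D₃'))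
      (bgConst β cr m₀ c35 a₀ + bgConst1 β cr m₀ c35 a₀) (δ - σ) γ c' := by
  have h0 := hasMaj_entry0_background blk π htri hd hσ hcr hrow hσδ hβ hm₀ hθ hc35 ha₀ hq hM hα₀ hMα hG hG' hDG hreg
  have h1 := hasMaj_entry13_background blk π htri hd hσ hcr hrow hσδ hβ hm₀ hθ hc35 ha₀ hq hM hα₀ hMα hG hG' hD₁' hDG hDD₁ hreg
  have h2 := hasMaj_entry2_background blk π htri hd hσ hcr hrow hσδ hβ hm₀ hθ hc35 hq hM hα₀ hMα hG hG' hS hDG hDS hreg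
  have h3 := hasMaj_entry13_background blk π htri hd hσ hcr hrow hσδ hβ hm₀ hθ hc35 ha₀ hq hM hα₀ hMα hG hG' hD₃' hDG hDD₃ hreg
  have hC0 : 0 ≤ bgConst β cr m₀ c35 a₀ := bgConst_nonneg hβ hcr hm₀ hc35.le ha₀
  have hC1 : 0 ≤ bgConst1 β cr m₀ c35 a₀ := bgConst1_nonneg hβ hcr hm₀ hc35.le ha₀
  have hB₀ : 0 ≤ bgConst β cr m₀ c35 a₀ + bgConst1 β cr m₀ c35 a₀ := add_nonneg hC0 hC1
  refine etaRateIneq342_of_hasMaj (g := g) (B := coeffBg π M θ) blk (blk ∘ π) hη.le hL.le hB₀ (bgOps4 π G D₁ S D₃ G' D₁' S' D₃') c' fun n => ?_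
  -- the common domination: `B·θ·e^{−(δ−σ)d} ≤ B₀·pref4·e^{−(δ−σ)d}·max(rf y, rf y′)` for `0 ≤ B ≤ B₀`
  have hdom : ∀ {B : ℝ}, 0 ≤ B → B ≤ bgConst β cr m₀ c35 a₀ + bgConst1 β cr m₀ c35 a₀ → ∀ y y' : g.Site,
      B * θ * Real.exp (-((δ - σ) * g.dist y y')) ≤
        (bgConst β cr m₀ c35 a₀ + bgConst1 β cr m₀ c35 a₀) * B9.pref4 ((opGeo g X blk).len y) n * Real.exp (-((δ - σ) * g.dist y y')) *
          max (rateFactor (opGeo g X blk) γ y) (rateFactor (opGeo g X blk) γ y') := by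
    intro B hB0 hB y y'
    have hpref : 1 ≤ B9.pref4 ((opGeo g X blk).len y) n := by rw [opGeo_len]; exact one_le_pref4 (hlen y) n
    have hrf : θ ≤ max (rateFactor (opGeo g X blk) γ y) (rateFactor (opGeo g X blk) γ y') := by
      rw [rateFactor_opGeo g X blk hη.ne' hL γ y']
      exact (hθγ y').trans (le_max_right _ _)
    have hE : 0 ≤ Real.exp (-((δ - σ) * g.dist y y')) := Real.exp_nonneg _
    calc B * θ * Real.exp (-((δ - σ) * g.dist y y'))
        ≤ ((bgConst β cr m₀ c35 a₀ + bgConst1 β cr m₀ c35 a₀) * B9.pref4 ((opGeo g X blk).len y) n) * θ *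
            Real.exp (-((δ - σ) * g.dist y y')) := by
          refine mul_le_mul_of_nonneg_right (mul_le_mul_of_nonneg_right ?_ hθ) hE
          calc B = B * 1 := (mul_one B).symm
            _ ≤ (bgConst β cr m₀ c35 a₀ + bgConst1 β cr m₀ c35 a₀) * B9.pref4 ((opGeo g X blk).len y) n := mul_le_mul hB hpref zero_le_one hB₀
      _ = (bgConst β cr m₀ c35 a₀ + bgConst1 β cr m₀ c35 a₀) * B9.pref4 ((opGeo g X blk).len y) n * Real.exp (-((δ - σ) * g.dist y y')) * θ := by
          ring
      _ ≤ _ := mul_le_mul_of_nonneg_left hrf (mul_nonneg (mul_nonneg hB₀ (zero_le_one.trans hpref)) hE)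
  fin_cases n
  · exact h0.mono (hdom hC0 (le_add_of_nonneg_right hC1))
  · exact h1.mono (hdom hC1 (le_add_of_nonneg_left hC0))
  · exact h2.mono (hdom hC0 (le_add_of_nonneg_right hC1))
  · exact h3.mono (hdom hC1 (le_add_of_nonneg_left hC0))

end PerIndex

/-! ## §3 The node's first conjunct BY NAME: all four entries constructed, only the `U ≡ 1` layer displayed -/

section Node

variable {I : Type} (g : I → B6.Geometry) (X X' : I → Type) [∀ i, Fintype (X i)] [∀ i, Fintype (X' i)] [∀ i, DecidableEq (X i)]
  [∀ i, DecidableEq (X' i)] (blk : ∀ i, X i → (g i).Site) (π : ∀ i, X' i → X i) (nsh : I → ℕ) (hL0 : ∀ i, (g i).L ≠ 0) (θc θ : I → ℝ)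
  (G D₁ S D₃ : ∀ i, (X i → ℝ) →ₗ[ℝ] (X i → ℝ)) (G' D₁' S' D₃' : ∀ i, (X' i → ℝ) →ₗ[ℝ] (X' i → ℝ))

/-- **NE2⁺, OPERATOR LAYER — `T4EtaRate.NE2PlusOperator` BY NAME, ALL FOUR ENTRIES CONSTRUCTED, BACKGROUND BLOCK LIVE, ONLY THE `U ≡ 1` LAYER DISPLAYED.**
For ANY family of data — [B6] carriers with (2.54), `d ≥ 0`, a UNIFORM (2.61) row sum `(σ, c_r)`, `η, L > 0`, sites of physical size `≥ 1`; lattices blocked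
and paired; the `U ≡ 1` LAYER with UNIFORM letters: majorants `β·e^{−δd}` (`σ < δ`) of `G_i, S_i` (coarse) and `G′_i, D₁′_i, D₃′_i` (fine) and η-defects
`m₀·θ_i·e^{−δd}` of the four pairs `(G′,G), (D₁′,D₁), (S′,S), (D₃′,D₃)` with rate numbers `0 ≤ θ_i ≤ (L^j)^{−γ}` (`γ > 0`) — and `c₃₅ > 0`: the realised
paired instances over the coefficient carriers (size parameter = the datum's `M`) with the kernel families `bgFamily4` satisfy `NE2PlusOperator c₃₅`
(`M₅ = 1`, `a₀ = (2c₃₅(βc_r + 1))⁻¹`, `B₀ = bgConst + bgConst1 + 1`, `δ₀ = δ − σ`, exponent `γ`); (3.35) is CONSUMED.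
[cite: Balaban1985BackgroundPropagators, Thm 3.1 p.397 (quantifier template); (3.35) p.396, (3.63)–(3.65) pp.402–403 (shapes, mechanism); King1986, Prop. 3.9 (3.73) p.665 (shape)] -/
theorem ne2PlusOperator_background4 (c35 : ℝ) (hc35 : 0 < c35)
    (htri : ∀ i, Triangle254 (g i)) (hd : ∀ i (a b : (g i).Site), 0 ≤ (g i).dist a b) {σ cr : ℝ} (hσ : 0 ≤ σ) (hcr : 0 ≤ cr)
    (hrow : ∀ i, RowSum (g i) σ cr) (hη : ∀ i, 0 < (g i).eta) (hL : ∀ i, 0 < (g i).L) (hlen : ∀ i y, 1 ≤ (g i).len y)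
    {δ β m₀ γ : ℝ} (hσδ : σ < δ) (hβ : 0 ≤ β) (hm₀ : 0 ≤ m₀) (hγ : 0 < γ) (hθ : ∀ i, 0 ≤ θ i) (hθγ : ∀ i y, θ i ≤ rateWeight (g i) γ y)
    (hG : ∀ i, HasMaj (BlockNorm.ofBlocks (g i) (blk i)) (BlockNorm.ofBlocks (g i) (blk i)) (G i)
      (fun y y' => β * Real.exp (-(δ * (g i).dist y y'))))
    (hG' : ∀ i, HasMaj (BlockNorm.ofBlocks (g i) (blk i ∘ π i)) (BlockNorm.ofBlocks (g i) (blk i ∘ π i)) (G' i)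
      (fun y y' => β * Real.exp (-(δ * (g i).dist y y'))))
    (hS : ∀ i, HasMaj (BlockNorm.ofBlocks (g i) (blk i)) (BlockNorm.ofBlocks (g i) (blk i)) (S i)
      (fun y y' => β * Real.exp (-(δ * (g i).dist y y'))))
    (hD₁' : ∀ i, HasMaj (BlockNorm.ofBlocks (g i) (blk i ∘ π i)) (BlockNorm.ofBlocks (g i) (blk i ∘ π i)) (D₁' i)
      (fun y y' => β * Real.exp (-(δ * (g i).dist y y'))))
    (hD₃' : ∀ i, HasMaj (BlockNorm.ofBlocks (g i) (blk i ∘ π i)) (BlockNorm.ofBlocks (g i) (blk i ∘ π i)) (D₃' i)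
      (fun y y' => β * Real.exp (-(δ * (g i).dist y y'))))
    (hDG : ∀ i, HasMaj (BlockNorm.ofBlocks (g i) (blk i)) (BlockNorm.ofBlocks (g i) (blk i ∘ π i)) (idef (pull (π i)) (pull (π i)) (G' i) (G i))
      (fun y y' => m₀ * θ i * Real.exp (-(δ * (g i).dist y y'))))
    (hDD₁ : ∀ i, HasMaj (BlockNorm.ofBlocks (g i) (blk i)) (BlockNorm.ofBlocks (g i) (blk i ∘ π i)) (idef (pull (π i)) (pull (π i)) (D₁' i) (D₁ i))
      (fun y y' => m₀ * θ i * Real.exp (-(δ * (g i).dist y y'))))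
    (hDS : ∀ i, HasMaj (BlockNorm.ofBlocks (g i) (blk i)) (BlockNorm.ofBlocks (g i) (blk i ∘ π i)) (idef (pull (π i)) (pull (π i)) (S' i) (S i))
      (fun y y' => m₀ * θ i * Real.exp (-(δ * (g i).dist y y'))))
    (hDD₃ : ∀ i, HasMaj (BlockNorm.ofBlocks (g i) (blk i)) (BlockNorm.ofBlocks (g i) (blk i ∘ π i)) (idef (pull (π i)) (pull (π i)) (D₃' i) (D₃ i))
      (fun y y' => m₀ * θ i * Real.exp (-(δ * (g i).dist y y')))) :
    NE2PlusOperator c35 (fun i => bgInstance (blk i) (π i) (nsh i) (hL0 i) (θc i) (θ i))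
      (fun i => bgFamily4 (blk i) (π i) (nsh i) (hL0 i) (θc i) (θ i) (G i) (D₁ i) (S i) (D₃ i) (G' i) (D₁' i) (S' i) (D₃' i)) := by
  -- the guard constant: `β·(c₃₅a₀)·c_r ≤ ½`
  set a₀ : ℝ := (2 * c35 * (β * cr + 1))⁻¹ with ha₀_def
  have hden : 0 < 2 * c35 * (β * cr + 1) := by positivity
  have ha₀ : 0 < a₀ := inv_pos.2 hden
  have hq : β * (c35 * a₀) * cr ≤ 1 / 2 := by
    have h1 : β * (c35 * a₀) * cr = (β * cr) * (c35 * a₀) := by ring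
    have h2 : c35 * a₀ = (2 * (β * cr + 1))⁻¹ := by
      rw [ha₀_def]; field_simp
    rw [h1, h2, ← div_eq_mul_inv, div_le_iff₀ (by positivity)]
    nlinarith [mul_nonneg hβ hcr]
  have hC0 : 0 ≤ bgConst β cr m₀ c35 a₀ := bgConst_nonneg hβ hcr hm₀ hc35.le ha₀.le
  have hC1 : 0 ≤ bgConst1 β cr m₀ c35 a₀ := bgConst1_nonneg hβ hcr hm₀ hc35.le ha₀.le
  refine ⟨1, δ - σ, a₀, bgConst β cr m₀ c35 a₀ + bgConst1 β cr m₀ c35 a₀ + 1, γ, one_pos, by linarith, ha₀,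
    by linarith, hγ, fun i hM α₀ hα₀ hMα c' hreg => ?_⟩
  have hM' : 1 ≤ (g i).M := hM
  have hMα' : (g i).M * α₀ ≤ a₀ := hMα
  have key := etaRateIneq342_background4 (blk i) (π i) (htri i) (hd i) hσ hcr (hrow i) (hη i) (hL i) (hlen i) hσδ.le hβ hm₀ (hθ i) (hθγ i)
    hc35 ha₀.le hq hM' hα₀ hMα' (hG i) (hG' i) (hS i) (hD₁' i) (hD₃' i) (hDG i) (hDD₁ i) (hDS i) (hDD₃ i) hreg
  -- `EtaRateIneq342` is monotone in `B₀` (`B₀ ↦ B₀ + 1`, to display a strictly positive constant)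
  intro n lam y y' hs
  refine (key n lam y y' hs).trans ?_
  have hpref : 0 ≤ B9.pref4 ((bgInstance (blk i) (π i) (nsh i) (hL0 i) (θc i) (θ i)).gc.len y) n := by
    have : 1 ≤ B9.pref4 ((opGeo (g i) (X i) (blk i)).len y) n := by rw [opGeo_len]; exact one_le_pref4 (hlen i y) n
    exact zero_le_one.trans this
  have hrf : 0 ≤ max (rateFactor (bgInstance (blk i) (π i) (nsh i) (hL0 i) (θc i) (θ i)).gc γ y)
      (rateFactor (bgInstance (blk i) (π i) (nsh i) (hL0 i) (θc i) (θ i)).gc γ y') :=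
    (T4EtaRate.rateFactor_nonneg (g := opGeo (g i) (X i) (blk i)) (hη i).le (hL i).le γ y).trans (le_max_left _ _)
  have hnorm : 0 ≤ (bgInstance (blk i) (π i) (nsh i) (hL0 i) (θc i) (θ i)).gc.supNorm lam :=
    Real.iSup_nonneg fun x => abs_nonneg _
  have hE : 0 ≤ Real.exp (-((δ - σ) * (bgInstance (blk i) (π i) (nsh i) (hL0 i) (θc i) (θ i)).gc.dist y y')) := Real.exp_nonneg _
  exact mul_le_mul_of_nonneg_right (mul_le_mul_of_nonneg_right (mul_le_mul_of_nonneg_right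
    (mul_le_mul_of_nonneg_right (le_add_of_nonneg_right zero_le_one) hpref) hE) hrf) hnorm

end Node

end Summit.QuantumFields.YangMills.BalabanUVNodes.N15.BackgroundLayer
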